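import Literature.Algebra.Homology.DiscreteRepInvariantsQuotient
import Mathlib.Algebra.Homology.DerivedCategory.Ext.Map
import HarnessLib

/-!
# Inflation `C_{Γ/N} ⥤ C_Γ` is EXACT; the induced maps `Extⁿ_{C_{Γ/N}}(X, Y) → Extⁿ_{C_Γ}(Inf X, Inf Y)`
# (Harari §4.3 Remark 4.24; Serre I §2.6)

Topic `Algebra/Homology`; namespace `Literature.Algebra.Homology.DiscreteRep`.  Sequel to -w6 g10's `DiscreteRepInflationQuotient`
(`inflQuotFunctor k N : DiscreteRepCat k (Γ ⧸ N) ⥤ DiscreteRepCat k Γ` for ANY normal `N`, identity on vectors) and -w7 g11's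
`DiscreteRepInvariantsQuotient` (additivity; elementwise exactness in `C_Γ`).  One plumbing definition with body (`inflExtHom`)
and theorems; no named fact, no instance, no `sorry`.

* §1 **`shortExact_map_inflQuotFunctor`**: inflation carries short exact sequences to short exact sequences (it is the identity on
  vectors, and monos / epis / exactness in `C_Γ` are detected on vectors); hence **`preservesFiniteLimits_inflQuotFunctor`**,
  **`preservesFiniteColimits_inflQuotFunctor`** (Mathlib's criteria `preservesFinite(Co)Limits_iff_forall_exact_map_and_mono/epi`).
* §2 **`inflExtHom N X Y n : Ext X Y n →+ Ext (Inf X) (Inf Y) n`** := Mathlib's `Ext.mapExactFunctor` for the exact functor `Inf`,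
  with `inflExtHom_mk₀` (`[f] ↦ [Inf f]`), `inflExtHom_comp` (multiplicative for the Yoneda product) and `inflExtHom_extClass`
  (the class of `S` goes to the class of `Inf S`) — the INFLATION on `Ext` along `Γ ↠ Γ/N` in door-c4's categories, for a
  closed (not necessarily open) normal subgroup, e.g. `Γ_K ↠ G_S = Γ_K ⧸ N_S`.

Cell bsd-eis, lane «PT-Ш-S-TC» (seat bsd-line-x1-p1-w6 gen 11): the tool for comparing the `S`-class-formation `Ext`-road objects
over `G_S` with the all-places ones over `Γ_K` ((R4)_S, (Λ)).  HONEST FRAMING: generic homological algebra; nothing arithmetic here.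

## References
* D. Harari, *Galois Cohomology and Class Field Theory*, Universitext, Springer (2020), §4.3 Remark 4.24. [Harari2020]
* J.-P. Serre, *Galois Cohomology*, Springer (1997), I §2.6. [SerreGaloisCohomology1997]
* C. A. Weibel, *An introduction to homological algebra* (1994), §2.7, §10.7. [Weibel1994]
-/

noncomputable section

universe u

namespace Literature.Algebra.Homology

/-- Exactness of a short complex of representations is exactness of the underlying modules (reflected by the faithful
forgetful functor; universe-polymorphic so that `forget₂` is elaborated once). [folklore] -/
private theorem repShortComplex_exact_of_apply'' {k G : Type u} [CommRing k] [Group G] (T : CategoryTheory.ShortComplex (Rep.{u} k G))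
    (hex : ∀ x, T.g.hom x = 0 → ∃ y, T.f.hom y = x) : T.Exact := by
  apply (CategoryTheory.forget₂ (Rep k G) (ModuleCat k)).reflects_exact_of_faithful
  rw [CategoryTheory.ShortComplex.moduleCat_exact_iff]
  exact hex

namespace DiscreteRep

open CategoryTheory CategoryTheory.Limits CategoryTheory.Abelian

variable {k Γ : Type u} [CommRing k] [Group Γ] [TopologicalSpace Γ] [IsTopologicalGroup Γ]
variable (N : Subgroup Γ) [N.Normal]

/-! ## §1. Inflation is exact -/

/-- **Inflation carries short exact sequences of `C_{Γ/N}` to short exact sequences of `C_Γ`** (identity on vectors).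
[cite: Harari2020, §4.3 Remark 4.24] [cite: SerreGaloisCohomology1997, I §2.6] -/
theorem shortExact_map_inflQuotFunctor {S : ShortComplex (DiscreteRepCat k (Γ ⧸ N))} (hS : S.ShortExact) :
    (S.map (inflQuotFunctor k N)).ShortExact := by
  haveI : (ι k Γ).PreservesHomology :=
    ⟨fun _ _ f => (isDiscrete k Γ).preservesKernels_ι f, fun _ _ f => (isDiscrete k Γ).preservesCokernels_ι f⟩
  refine { exact := ?_, mono_f := ?_, epi_g := ?_ }
  · rw [← ShortComplex.exact_map_iff_of_faithful _ (ι k Γ)]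
    exact repShortComplex_exact_of_apply'' _ fun x hx => exact_apply hS.exact x hx
  · exact (ι k Γ).mono_of_mono_map ((Rep.mono_iff_injective _).2 fun a b h => shortExact_f_injective hS h)
  · exact (ι k Γ).epi_of_epi_map ((Rep.epi_iff_surjective _).2 fun y => shortExact_g_surjective hS y)

/-- **Inflation preserves finite limits** (left exact). [cite: Harari2020, §4.3 Remark 4.24] -/
theorem preservesFiniteLimits_inflQuotFunctor : PreservesFiniteLimits (inflQuotFunctor k N) :=
  ((inflQuotFunctor k N).preservesFiniteLimits_iff_forall_exact_map_and_mono).2 fun _ hS =>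
    ⟨(shortExact_map_inflQuotFunctor N hS).exact, (shortExact_map_inflQuotFunctor N hS).mono_f⟩

/-- **Inflation preserves finite colimits** (right exact). [cite: Harari2020, §4.3 Remark 4.24] -/
theorem preservesFiniteColimits_inflQuotFunctor : PreservesFiniteColimits (inflQuotFunctor k N) :=
  ((inflQuotFunctor k N).preservesFiniteColimits_iff_forall_exact_map_and_epi).2 fun _ hS =>
    ⟨(shortExact_map_inflQuotFunctor N hS).exact, (shortExact_map_inflQuotFunctor N hS).epi_g⟩

/-! ## §2. Inflation on `Ext` -/

section ExtMap

variable (X Y : DiscreteRepCat k (Γ ⧸ N)) (n : ℕ)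

/-- **Inflation on `Ext`: `Extⁿ_{C_{Γ/N}}(X, Y) →+ Extⁿ_{C_Γ}(Inf X, Inf Y)`** (Mathlib's `Ext.mapExactFunctor` for the exact
functor `Inf`). [cite: Harari2020, §4.3 Remark 4.24] [cite: Weibel1994, §10.7] -/
def inflExtHom : Ext X Y n →+ Ext ((inflQuotFunctor k N).obj X) ((inflQuotFunctor k N).obj Y) n :=
  haveI := preservesFiniteLimits_inflQuotFunctor (k := k) N
  haveI := preservesFiniteColimits_inflQuotFunctor (k := k) N
  (inflQuotFunctor k N).mapExtAddHom X Y n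

variable {X Y n}

/-- `inflExtHom` is `Ext.mapExactFunctor`. [cite: Weibel1994, §10.7] -/
theorem inflExtHom_apply (e : Ext X Y n) :
    inflExtHom N X Y n e =
      (haveI := preservesFiniteLimits_inflQuotFunctor (k := k) N
       haveI := preservesFiniteColimits_inflQuotFunctor (k := k) N
       e.mapExactFunctor (inflQuotFunctor k N)) := rfl

/-- **`Inf [f] = [Inf f]`** on `Ext⁰`. [cite: Weibel1994, §10.7] -/
@[simp]
theorem inflExtHom_mk₀ (f : X ⟶ Y) : inflExtHom N X Y 0 (Ext.mk₀ f) = Ext.mk₀ ((inflQuotFunctor k N).map f) := by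
  haveI := preservesFiniteLimits_inflQuotFunctor (k := k) N
  haveI := preservesFiniteColimits_inflQuotFunctor (k := k) N
  exact Ext.mapExactFunctor_mk₀ (inflQuotFunctor k N) f

/-- **`Inf (α ∘ β) = Inf α ∘ Inf β`** (Yoneda product). [cite: Weibel1994, §10.7] -/
theorem inflExtHom_comp {Z : DiscreteRepCat k (Γ ⧸ N)} {a b c : ℕ} (α : Ext X Y a) (β : Ext Y Z b) (h : a + b = c) :
    inflExtHom N X Z c (α.comp β h) = (inflExtHom N X Y a α).comp (inflExtHom N Y Z b β) h := by
  haveI := preservesFiniteLimits_inflQuotFunctor (k := k) N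
  haveI := preservesFiniteColimits_inflQuotFunctor (k := k) N
  exact Ext.mapExactFunctor_comp (inflQuotFunctor k N) α β h

/-- **`Inf [S] = [Inf S]`**: the class of a short exact `S` inflates to the class of the (short exact) inflated sequence.
[cite: Weibel1994, §10.7] [cite: SerreGaloisCohomology1997, I §2.6] -/
theorem inflExtHom_extClass {S : ShortComplex (DiscreteRepCat k (Γ ⧸ N))} (hS : S.ShortExact) :
    inflExtHom N S.X₃ S.X₁ 1 hS.extClass = (shortExact_map_inflQuotFunctor N hS).extClass := by
  haveI := preservesFiniteLimits_inflQuotFunctor (k := k) N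
  haveI := preservesFiniteColimits_inflQuotFunctor (k := k) N
  exact Ext.mapExactFunctor_extClass (inflQuotFunctor k N) hS

/-- `Inf 0 = 0`, `Inf (e + e') = Inf e + Inf e'` (additivity, restated). [cite: Weibel1994, §10.7] -/
theorem inflExtHom_add (e e' : Ext X Y n) : inflExtHom N X Y n (e + e') = inflExtHom N X Y n e + inflExtHom N X Y n e' :=
  map_add _ e e'

end ExtMap

end DiscreteRep

end Literature.Algebra.Homology

end
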